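import Summits.QuantumFields.YangMills.Theorems.BalabanUVNodesN12SlicePreimageLetterOfClass
import Summits.QuantumFields.YangMills.Theorems.BalabanUVNodesN12SliceDatumLevelZeroLinear
import HarnessLib

/-!
# BalabanUVNodes ∕ N12 — THE MULTIPLIER ROW (M) OF THE (β)-SPLIT FOR EVERY (2.12)-CLASS MINIMISER, FROM THE CLASS, THE (δ) ROW AND THE FOREST ROWS, MODULO THE CHART-CURVATURE
# LETTER (R2) ONLY — the junction of this seat's files C (`…N12SlicePreimageLetterOfClass.multiplierLetter_Bj_of_isMinimizer_class`, (R1a) discharged) and D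
# (`…N12SliceDatumLevelZeroLinear.curvatureData_levelZeroFree`, (R1b) discharged)
# ([Balaban1989LargeFieldII] (1.12)–(1.13) p. 359; [Balaban1985Variational] Sect. C (44)–(48) p. 285, (82)–(83) p. 290; [Balaban1988Convergent] (2.2) p. 255, (2.10)–(2.13) pp. 256–257)

Cell `pub-ymgap` (HUMAN RULINGS D-0062 ∕ D-0149), WIDTH SEAT `pub-ymgap-dag-n12-w6` g14 (node N12 = [B15]; key K1⁹ `stmt-QuantumFields-27364`, `--kind proof --supports … --as helper`;
count-neutral).  ONE THEOREM, by name over files C and D (lane owner's tower guards `…N12TowerGuardsOfClass.guardOn_towerRegion_Bj_of_mem_class` for D's hypotheses).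

WHAT REMAINS DISPLAYED in the (M) row after this file: (R2) `‖D²Φ₀(0)[p̂,p̂]‖ ≤ M₂·Σ_b‖p b‖²` (the chart curvature in `Φ₀` currency, (P5)) and the (δ) row (bondwise `δ`-flatness of `U₀` on
the plaquettes meeting the bonds sourced in `Ω₁(Z)` — the direct road's (N)-package clause); `m := 8(d−1)·δ·B₁·M₂`, `B₁ := √2·(1 + 2·#bonds·Lp)·√#bonds·B` per height.

HONEST FRAMING.  Composition by name; per-height (volume-dependent) EXISTENCE letters — print's volume-uniform (46) NOT claimed; (R2) and (P) untouched; nothing of Bałaban's asserted; N12 NOT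
discharged; K1⁹ NOT closed; counts of record unmoved (typed 28∕28 · discharged 8∕27); one finite 𝕋⁴ programme at fixed ε — R4 closes the conditional rung `BalabanLadder.UV` only; no summit
statement is proved here and NOT the Yang–Mills mass gap (Clay); nothing continuum ∕ ℝ⁴ ∕ OS.
-/

noncomputable section

namespace Summit.QuantumFields.YangMills.BalabanUVNodes.N12MultiplierLetterOfClass

open scoped BigOperators Matrix.Norms.L2Operator Topology
open Literature.MathematicalPhysics.QuantumFieldTheory.Balaban1983to89
open T4Continuum
open B15DeterminingSets GaugeField
open BlockAveraging (blockAvg)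
open ExpMeanLog (expMeanLogSU)
open T4AdjointCovarianceUnitary (lieSU)
open Node00
open B15SU2ChartHolomorphic (genE expMulC logCoordC)
open B15AveragingHolomorphic (iterMh)
open B15Prop1AnalyticExtClause (cplxVec)
open B15Prop1ChartCalculusSU2 (E3)
open T4CubeChartGnomonic (SU2)
open B5Eq118OneStroke (iterBlockOf)
open B14.Eq213DetSet (Bj maxDomT)
open B14.Eq213MaximalDomains (side)
open B14.Eq216Concrete (feeds)
open B15Eq112TorusCover (lift)
open T4AxialGaugeSmallField (boxPlaqs)
open Summit.QuantumFields.YangMills.BalabanUVNodes.N12SlicePreimageLetterOfClass (multiplierLetter_Bj_of_isMinimizer_class)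
open Summit.QuantumFields.YangMills.BalabanUVNodes.N12SliceDatumLevelZeroLinear (curvatureData_levelZeroFree)
open Summit.QuantumFields.YangMills.BalabanUVNodes.N12TowerGuardsOfClass (guardOn_towerRegion_Bj_of_mem_class)

variable {F : T4Family} {k : ℕ}

/-- ★★★ **THE MULTIPLIER ROW (M) FOR EVERY (2.12)-CLASS MINIMISER, MODULO THE CURVATURE LETTER (R2) ONLY**: per base field (a minimiser `U₀` of ANY constrained problem over the class of
record — membership + fibre —, a rooted forest with (F1), roots ⊇ `R(𝐁_k(Z), k)`, slice (F3) and `hlen`, the slice action `a` and the slice datum coordinates `Φ₀` by their formulas, the (δ)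
row at `δ`), once per height (`hHB`'s ∀-body at `(εH, B)`, `hsbU`, floors, numerics), and the ONE displayed letter (R2) `‖D²Φ₀(0)[p̂,p̂]‖ ≤ M₂·Σ_b‖p b‖²`: for every multiplier `ℓ₀` with
`fderiv ℂ a 0 = ℓ₀ ∘L fderiv ℂ Φ₀ 0` and every real kernel direction, `Re ℓ₀(D²Φ₀(0)[p̂,p̂]) ≤ (8(d−1)·δ·B₁·M₂)·Σ_b‖p b‖²`, `B₁ = √2·(1 + 2·#bonds·Lp)·√#bonds·B` — file C with (R1b) fed by file D
(tower guards from the class). [cite: Balaban1989LargeFieldII, (1.12)–(1.13) p.359, p.357; Balaban1985Variational, Sect. C (44)–(48) p.285, (82)–(83) p.290; Balaban1988Convergent, (2.2) p.255, (2.10)–(2.13) pp.256–257; Balaban1985BackgroundPropagators, (3.7) p.391] -/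
theorem multiplierLetter_Bj_of_isMinimizer_class_of_curvatureLetter (ν : Node00.Stage7Numerics) (Kt : ℕ) (Z : Set (Site (F.P Kt) 0)) (hk0 : 0 < k)
    (hkK : k + 1 ≤ (F.P Kt).m + (F.P Kt).K) (hM4 : 4 * (F.P Kt).L ≤ ν.M₁) (hdiv : side (F.P Kt).L ν.M₁ k ∣ (F.P Kt).sitesPerDir 0) (hε : 0 ≤ ν.εreg)
    {ρ'' : ℝ} (hsbU : ∀ V : GaugeField (F.P Kt) 0 SU2, ‖coeField V - 1‖ ≤ ρ'' → SmallBelow (avOfRecord F 2 Kt) k V)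
    (hερ : 6 * ((((F.P Kt).d - 1 : ℕ)) : ℝ) * (F.P Kt).L * ν.εreg ≤ ρ'')
    {εH B : ℝ}
    (hHB : ∀ (Wd : MSField (F.P Kt) SU2) (U₀ : GaugeField (F.P Kt) 0 SU2),
      AgreeOn (Bj ν.M₁ Z k) (avgFamily (avOfRecord F 2 Kt) U₀) Wd →
      (∀ i' : Fin (constrCard (Bj ν.M₁ Z k) k), ∃ U' : GaugeField (F.P Kt) 0 SU2,
        (∀ b ∈ feeds (((constrEnum (Bj ν.M₁ Z k) k).symm i').1 : ℕ) ((constrEnum (Bj ν.M₁ Z k) k).symm i').2.1, U' b = U₀ b) ∧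
          SmallBelow (avOfRecord F 2 Kt) k U') →
      (∀ (j : ℕ), 1 ≤ j → j ≤ k → ∀ y : Site (F.P Kt) j, embIter j y ∈ maxDomT ν.M₁ Z j → ∃ U' : GaugeField (F.P Kt) 0 SU2,
        (∀ c : PBond (F.P Kt) j, (c.src = y ∨ c.tgt = y) → ∀ b₀ : PBond (F.P Kt) 0,
          (iterBlockOf j b₀.src = c.src ∨ iterBlockOf j b₀.src = c.tgt) → (iterBlockOf j b₀.tgt = c.src ∨ iterBlockOf j b₀.tgt = c.tgt) → U' b₀ = U₀ b₀) ∧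
        SmallBelow (avOfRecord F 2 Kt) k U') →
      (∀ (j : ℕ), 1 ≤ j → j ≤ k → ∀ y : Site (F.P Kt) j, embIter j y ∈ maxDomT ν.M₁ Z j →
        PlaqSmallOn (boxPlaqs (fun κ => lift (F.P Kt) (embIter j y) κ - ((((F.P Kt).L ^ j : ℕ) : ℤ) + ((((F.P Kt).L ^ j - 1) / 2 : ℕ) : ℤ)))
          (fun κ => lift (F.P Kt) (embIter j y) κ + ((((F.P Kt).L ^ j : ℕ) : ℤ) + ((((F.P Kt).L ^ j - 1) / 2 : ℕ) : ℤ))) : Set (Plaq (F.P Kt) 0)) εH U₀) →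
      ∃ H : (Fin (constrCard (Bj ν.M₁ Z k) k) → lieSU (Fin 2)) → PBond (F.P Kt) 0 → lieSU (Fin 2),
        (∀ v, fderiv ℝ (msChart F 2 Kt k (Bj ν.M₁ Z k) Wd U₀) 0 (H v) = v) ∧ ∀ v, Real.sqrt (∑ b, ‖H v b‖ ^ 2) ≤ B * ‖v‖)
    (hεH : ν.εreg ≤ εH) (hB0 : 0 ≤ B)
    {𝔹' : DetSet (F.P Kt)} {W' : MSField (F.P Kt) SU2} {U₀ : GaugeField (F.P Kt) 0 SU2}
    (hmin : IsMinimizer (avOfRecord F 2 Kt) (regMSCoPOfRecord F 2 ν Kt k (maxDomT ν.M₁ Z)) 𝔹' W' U₀)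
    {W : MSField (F.P Kt) SU2} (hW : AgreeOn (Bj ν.M₁ Z k) (avgFamily (avOfRecord F 2 Kt) U₀) W)
    (S : Submodule ℂ (VecField (F.P Kt) 0 (EuclideanSpace ℂ (Fin 3)))) {path : Site (F.P Kt) 0 → List (LStep (F.P Kt) 0)}
    (hroot : ∀ r ∈ {z : Site (F.P Kt) 0 | ∃ j, j ≤ k ∧ ∃ c ∈ bondsOf ((Bj ν.M₁ Z k : DetSet (F.P Kt)) j), (z = embIter j c.src ∨ z = embIter j c.tgt)}, path r = [])
    (hF1 : ∀ x, ∀ s ∈ path x, ∃ x' x'' : Site (F.P Kt) 0, path x'' = path x' ++ [s] ∧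
      (s.fwd = true → s.bond.src = x' ∧ s.bond.tgt = x'') ∧ (s.fwd = false → s.bond.src = x'' ∧ s.bond.tgt = x'))
    (hF3 : ∀ Y : VecField (F.P Kt) 0 (EuclideanSpace ℂ (Fin 3)), Y ∈ S ↔ ∀ x, ∀ s ∈ path x, Y s.bond = 0)
    {Lp : ℕ} (hlen : ∀ x, (path x).length ≤ Lp)
    {a : S → ℂ}
    (ha : ∀ X : S, a X = ∑ q : Plaq (F.P Kt) 0, (1 - (expMulC (X : VecField (F.P Kt) 0 (EuclideanSpace ℂ (Fin 3))) (coeField U₀) ⟨q.src, q.μ⟩ *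
      expMulC (X : VecField (F.P Kt) 0 (EuclideanSpace ℂ (Fin 3))) (coeField U₀) ⟨q.src.shift q.μ, q.ν⟩ *
      Matrix.adjugate (expMulC (X : VecField (F.P Kt) 0 (EuclideanSpace ℂ (Fin 3))) (coeField U₀) ⟨q.src.shift q.ν, q.μ⟩) *
      Matrix.adjugate (expMulC (X : VecField (F.P Kt) 0 (EuclideanSpace ℂ (Fin 3))) (coeField U₀) ⟨q.src, q.ν⟩)).trace / 2))
    {Φ₀ : S → Fin (constrCard (Bj ν.M₁ Z k) k) → EuclideanSpace ℂ (Fin 3)}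
    (hΦ₀ : ∀ (X : S) i, Φ₀ X i = logCoordC (star ((W ((constrEnum (Bj ν.M₁ Z k) k).symm i).1 ((constrEnum (Bj ν.M₁ Z k) k).symm i).2.1 : SU2) : Matrix (Fin 2) (Fin 2) ℂ) *
      iterMh ((constrEnum (Bj ν.M₁ Z k) k).symm i).1 (expMulC (X : VecField (F.P Kt) 0 (EuclideanSpace ℂ (Fin 3))) (coeField U₀)) ((constrEnum (Bj ν.M₁ Z k) k).symm i).2.1))
    {δ : ℝ} (hδ0 : 0 ≤ δ)
    (hU : ∀ q : Plaq (F.P Kt) 0, ((⟨q.src, q.μ⟩ : PBond (F.P Kt) 0) ∈ {b : PBond (F.P Kt) 0 | b.src ∈ maxDomT ν.M₁ Z 1} ∨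
          (⟨q.src.shift q.μ, q.ν⟩ : PBond (F.P Kt) 0) ∈ {b : PBond (F.P Kt) 0 | b.src ∈ maxDomT ν.M₁ Z 1} ∨
          (⟨q.src.shift q.ν, q.μ⟩ : PBond (F.P Kt) 0) ∈ {b : PBond (F.P Kt) 0 | b.src ∈ maxDomT ν.M₁ Z 1} ∨
          (⟨q.src, q.ν⟩ : PBond (F.P Kt) 0) ∈ {b : PBond (F.P Kt) 0 | b.src ∈ maxDomT ν.M₁ Z 1}) →
        ‖((U₀ ⟨q.src, q.μ⟩ : SU2) : Matrix (Fin 2) (Fin 2) ℂ) - 1‖ ≤ δ ∧ ‖((U₀ ⟨q.src.shift q.μ, q.ν⟩ : SU2) : Matrix (Fin 2) (Fin 2) ℂ) - 1‖ ≤ δ ∧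
          ‖((U₀ ⟨q.src.shift q.ν, q.μ⟩ : SU2) : Matrix (Fin 2) (Fin 2) ℂ) - 1‖ ≤ δ ∧ ‖((U₀ ⟨q.src, q.ν⟩ : SU2) : Matrix (Fin 2) (Fin 2) ℂ) - 1‖ ≤ δ)
    {M₂ : ℝ}
    -- (R2) DISPLAYED: the chart-curvature letter
    (hcurv : ∀ (p : VecField (F.P Kt) 0 E3) (hp : cplxVec p ∈ S), fderiv ℂ Φ₀ 0 ⟨cplxVec p, hp⟩ = 0 →
      ‖fderiv ℂ (fderiv ℂ Φ₀) 0 ⟨cplxVec p, hp⟩ ⟨cplxVec p, hp⟩‖ ≤ M₂ * ∑ b : PBond (F.P Kt) 0, ‖p b‖ ^ 2) :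
    ∀ ℓ₀ : (Fin (constrCard (Bj ν.M₁ Z k) k) → EuclideanSpace ℂ (Fin 3)) →L[ℂ] ℂ, fderiv ℂ a 0 = ℓ₀.comp (fderiv ℂ Φ₀ 0) →
      ∀ (p : VecField (F.P Kt) 0 E3) (hp : cplxVec p ∈ S), fderiv ℂ Φ₀ 0 ⟨cplxVec p, hp⟩ = 0 →
        (ℓ₀ (fderiv ℂ (fderiv ℂ Φ₀) 0 ⟨cplxVec p, hp⟩ ⟨cplxVec p, hp⟩)).re ≤
          (8 * (((F.P Kt).d : ℝ) - 1) * δ * (Real.sqrt 2 * ((1 + 2 * (Fintype.card (PBond (F.P Kt) 0)) * Lp) * Real.sqrt (Fintype.card (PBond (F.P Kt) 0)) * B)) * M₂) *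
            ∑ b : PBond (F.P Kt) 0, ‖p b‖ ^ 2 := by
  have hk : k ≤ (F.P Kt).m + (F.P Kt).K := by omega
  have hgU := guardOn_towerRegion_Bj_of_mem_class ν Kt Z hkK hM4 hdiv hε hsbU hερ hmin.1
  exact multiplierLetter_Bj_of_isMinimizer_class ν Kt Z hk0 hkK hM4 hdiv hε hsbU hερ hHB hεH hB0 hmin hW S hroot hF1 hF3 hlen ha hΦ₀ hδ0 hU
    (curvatureData_levelZeroFree (Bj ν.M₁ Z k) k hk W hgU hW S hΦ₀) hcurv

end Summit.QuantumFields.YangMills.BalabanUVNodes.N12MultiplierLetterOfClass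

end
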